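import Mathlib
import Literature.MathematicalPhysics.QuantumLattice.HubbardBandSectorCountingToolbox
import Literature.MathematicalPhysics.QuantumLattice.HubbardUmklappKinematics
import Summits.HubbardSuperconductivity.HubbardSuperconductivity.Theorems.KLProgrammeKLRegimeTwoPointLimitShellAngularTransversal
import HarnessLib

/-!
# Route `KLProgramme` — crux K3 `KLRegimeTwoPointLimit` (stmt-HubbardSuperconductivity-19937), support:
# Lemma E.3 PACKAGED near (not on) the caustic — the `δ/√dist(w, 2F)` law with constants depending only
# on the band window (DECOMP App. E; completes the five-regime form of E1-NOTE §2)

Cell `gate-hubbard-kl`, seat p1b; paper note `HOME/prover-p1b/E1-NOTE.md` §2 (second display, the bracket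
`min[δ/r₂(w)^{1/2}, δ^{1/2}]`) and §8. The companions `…ShellAngularBound` / `…ShellAngularBoundAway` package
the Cooper law `C δ/|w|_∞` and the uniform `C₁δ + C₂√δ` law. This file adds the INTERPOLATING law: for a
transfer `w` at torus sup-distance `≥ v` from the Cooper point `2πℤ²` and at sup-distance `≥ r` from the
caustic `2F_μ + 2πℤ²`, with `r ≥ c₀δ`,

* `klan_exists_caustic_refined` — there are `δ₁, c₀, C₁, C₃ > 0` (depending only on `B`, `η⋆`, `v`) with
  `|Θ_w(δ)| ≤ C₁·δ + C₃·δ/√r` for all `0 < δ ≤ δ₁`.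

Together with `klan_exists_away_bound` (`r < c₀δ`: there `√δ ≤ δ·√(c₀/r)`, so `C₂√δ` IS a `δ/√r` bound) this
is E1-NOTE's `C(δ + min[δ/√r₂, √δ])` away from the Cooper point: the angular measure is `O(δ)` in the
uniformly transversal regime and degrades only like `dist(w, 2F)^{-1/2}` towards the caustic — the sharp
form the caustic-keyed sector counts need (U5-NOTE §1(b)). Proof: `klsa_volume_sublevel_le_transversal`
with the count data of `…ShellAngularBoundAway` (`ρ₂, η₁, ℓ`) and the slope data `η = δ`,
`λ = min(v/(4 s C_g), √r/(2 C_g √A₂))` (the `r₂`-branch of `klst_slope_lower_bound`); `c₀ = 2/Dt + 1`,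
`δ₁ = min(η⋆, v/(4κ₂), Dt² c₀/(16 s² C_g² A₂))`, `C₁ = (2π/ℓ + 27)·4 s C_g/v`, `C₃ = (2π/ℓ + 27)·2 C_g √A₂`.
-/

noncomputable section

-- the tree's namespace `Summit.<Summit>.<Problem>.Theorems` repeats the summit name by design (D-0017)
set_option linter.dupNamespace false

open Real Set MeasureTheory
open scoped ENNReal
open Literature.MathematicalPhysics.QuantumLattice
open Literature.MathematicalPhysics.QuantumLattice.BandSectorCounting

namespace Summit.HubbardSuperconductivity.HubbardSuperconductivity.Theorems

section Main

variable {a b : ℝ} (B : BandBounds a b)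
include B

/-- **Lemma E.3 near the caustic, packaged (`δ/√dist` law).** For a margin `η⋆ > 0` and a threshold `v > 0`
there are `δ₁, c₀, C₁, C₃ > 0`, depending only on `B`, `η⋆`, `v`, such that for every level `μ` with
`μ ± η⋆` in the range, every `0 < δ ≤ δ₁`, every transfer `w` at torus sup-distance `≥ v` from `2πℤ²`,
every lower bound `r ≥ c₀ δ` of the sup-distance of `w` to the caustic `2F_μ + 2πℤ²`, and every period:
`|{θ ∈ [θ₀, θ₀ + 2π] : |ε(p_μ(θ) - w) - μ| ≤ δ}| ≤ C₁·δ + C₃·δ/√r`. -/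
theorem klan_exists_caustic_refined {ηs v : ℝ} (hηs : 0 < ηs) (hv0 : 0 < v) :
    ∃ δ₁ c₀ C₁ C₃ : ℝ, 0 < δ₁ ∧ 0 < c₀ ∧ 0 < C₁ ∧ 0 < C₃ ∧
      ∀ (μ : ℝ), a ≤ μ - ηs → μ + ηs ≤ b → ∀ (δ w₁ w₂ θ₀ r : ℝ), 0 < δ → δ ≤ δ₁ →
        (∀ m₀ m₁ : ℤ, v ≤ max |w₁ - m₀ * (2 * π)| |w₂ - m₁ * (2 * π)|) →
        c₀ * δ ≤ r →
        (∀ (m₀ m₁ : ℤ) (φ : ℝ),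
          r ≤ max |w₁ - m₀ * (2 * π) - 2 * bandX μ φ| |w₂ - m₁ * (2 * π) - 2 * bandY μ φ|) →
        volume {θ ∈ Icc θ₀ (θ₀ + 2 * π) | |eps2 (bandX μ θ - w₁) (bandY μ θ - w₂) - μ| ≤ δ} ≤
          ENNReal.ofReal (C₁ * δ + C₃ * δ / Real.sqrt r) := by
  have hπ := Real.pi_pos
  have hs := B.smax_pos
  have hC := B.Cg_pos
  have hD := B.Dtmin_pos
  have hρ := B.rhomin_pos
  have hA := B.A2_pos
  have hu := B.umin_pos
  have hh := B.hmin_pos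
  have hs' := hs.ne'
  have hC' := hC.ne'
  have hD' := hD.ne'
  have hA' := hA.ne'
  have hu' := hu.ne'
  have hh' := hh.ne'
  have hKb : umklappRadius b < π := umklappRadius_lt_pi B.hb
  have h2u : 0 < Real.sqrt 2 * B.umin := by positivity
  have h2u' := h2u.ne'
  have hsq2 : Real.sqrt 2 ≠ 0 := by positivity
  -- constants (opaque names with defining equations)
  obtain ⟨κ₂, hκ₂⟩ : ∃ x : ℝ, x = (2 * B.smax ^ 2 * B.Cg + 1) / B.Dtmin := ⟨_, rfl⟩
  obtain ⟨κ₃, hκ₃⟩ : ∃ x : ℝ, x = min (Real.sqrt 2 * B.umin) (2 * π - 2 * umklappRadius b) :=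
    ⟨_, rfl⟩
  obtain ⟨M₃, hM₃⟩ : ∃ x : ℝ, x =
    (4 * B.smax ^ 2 + 4 * B.A2) * (2 * B.smax * π / (Real.sqrt 2 * B.umin) + 1) := ⟨_, rfl⟩
  have hκ₂0 : 0 < κ₂ := by rw [hκ₂]; positivity
  have hκ₃0 : 0 < κ₃ := by rw [hκ₃]; exact lt_min h2u (by linarith)
  have hM₃0 : 0 < M₃ := by rw [hM₃]; positivity
  have hκ₂' := hκ₂0.ne'
  have hM₃' := hM₃0.ne'
  obtain ⟨ρ₂, hρ₂⟩ : ∃ x : ℝ, x = min (min (Real.sqrt 2 * B.umin) (κ₃ / 2)) (2 * B.hmin / M₃) :=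
    ⟨_, rfl⟩
  have hρ₂0 : 0 < ρ₂ := by rw [hρ₂]; exact lt_min (lt_min h2u (by positivity)) (by positivity)
  have hρ₂1 : ρ₂ ≤ Real.sqrt 2 * B.umin := by rw [hρ₂]; exact (min_le_left _ _).trans (min_le_left _ _)
  have hρ₂2 : ρ₂ ≤ κ₃ / 2 := by rw [hρ₂]; exact (min_le_left _ _).trans (min_le_right _ _)
  have hρ₂3 : ρ₂ ≤ 2 * B.hmin / M₃ := by rw [hρ₂]; exact min_le_right _ _
  obtain ⟨κ₄, hκ₄⟩ : ∃ x : ℝ, x = κ₂ + B.A2 * B.smax ^ 2 * B.Cg ^ 2 / B.Dtmin ^ 2 + 1 / 2 :=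
    ⟨_, rfl⟩
  have hκ₄0 : 0 < κ₄ := by rw [hκ₄]; positivity
  have hκ₄' := hκ₄0.ne'
  obtain ⟨η₁, hη₁⟩ : ∃ x : ℝ, x = min (min (min ηs 1) (ρ₂ / κ₄)) (v / (2 * κ₂)) := ⟨_, rfl⟩
  have hη₁0 : 0 < η₁ := by
    rw [hη₁]; exact lt_min (lt_min (lt_min hηs one_pos) (by positivity)) (by positivity)
  have hη₁1 : η₁ ≤ ηs := by
    rw [hη₁]; exact ((min_le_left _ _).trans (min_le_left _ _)).trans (min_le_left _ _)
  have hη₁2 : η₁ ≤ 1 := by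
    rw [hη₁]; exact ((min_le_left _ _).trans (min_le_left _ _)).trans (min_le_right _ _)
  have hη₁3 : η₁ ≤ ρ₂ / κ₄ := by rw [hη₁]; exact (min_le_left _ _).trans (min_le_right _ _)
  have hη₁4 : η₁ ≤ v / (2 * κ₂) := by rw [hη₁]; exact min_le_right _ _
  obtain ⟨ℓ, hℓ⟩ : ∃ x : ℝ, x = η₁ / (4 * B.smax) := ⟨_, rfl⟩
  have hℓ0 : 0 < ℓ := by rw [hℓ]; positivity
  have hℓ' := hℓ0.ne'
  -- slope constants
  obtain ⟨τ₀, hτ₀⟩ : ∃ x : ℝ, x = v / (4 * B.smax * B.Cg) := ⟨_, rfl⟩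
  have hτ₀0 : 0 < τ₀ := by rw [hτ₀]; positivity
  have hτ₀' := hτ₀0.ne'
  obtain ⟨c₀, hc₀⟩ : ∃ x : ℝ, x = 2 / B.Dtmin + 1 := ⟨_, rfl⟩
  have hc₀0 : 0 < c₀ := by rw [hc₀]; positivity
  have hc₀D : 2 / B.Dtmin ≤ c₀ := by rw [hc₀]; linarith
  obtain ⟨δ₁, hδ₁⟩ : ∃ x : ℝ, x = min (min ηs (v / (4 * κ₂)))
    (B.Dtmin ^ 2 * c₀ / (16 * B.smax ^ 2 * B.Cg ^ 2 * B.A2)) := ⟨_, rfl⟩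
  have hδ₁0 : 0 < δ₁ := by rw [hδ₁]; exact lt_min (lt_min hηs (by positivity)) (by positivity)
  have hδ₁1 : δ₁ ≤ ηs := by rw [hδ₁]; exact (min_le_left _ _).trans (min_le_left _ _)
  have hδ₁2 : δ₁ ≤ v / (4 * κ₂) := by rw [hδ₁]; exact (min_le_left _ _).trans (min_le_right _ _)
  have hδ₁3 : δ₁ ≤ B.Dtmin ^ 2 * c₀ / (16 * B.smax ^ 2 * B.Cg ^ 2 * B.A2) := by rw [hδ₁]; exact min_le_right _ _
  obtain ⟨C₁, hC₁⟩ : ∃ x : ℝ, x = (2 * π / ℓ + 27) / τ₀ := ⟨_, rfl⟩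
  obtain ⟨C₃, hC₃⟩ : ∃ x : ℝ, x = (2 * π / ℓ + 27) * (2 * B.Cg * Real.sqrt B.A2) := ⟨_, rfl⟩
  have hC₁0 : 0 < C₁ := by rw [hC₁]; positivity
  have hC₃0 : 0 < C₃ := by rw [hC₃]; positivity
  refine ⟨δ₁, c₀, C₁, C₃, hδ₁0, hc₀0, hC₁0, hC₃0, ?_⟩
  intro μ hlo hhi δ w₁ w₂ θ₀ r hδ hδδ₁ hv hr hr₂
  have hμ : μ ∈ Icc a b := ⟨by linarith, by linarith⟩
  have hKμ : umklappRadius μ ≤ umklappRadius b := umklappRadius_mono hμ.2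
  have hr0 : 0 < r := lt_of_lt_of_le (by positivity) hr
  have hsA : 0 < Real.sqrt B.A2 := Real.sqrt_pos.2 hA
  have hsr : 0 < Real.sqrt r := Real.sqrt_pos.2 hr0
  -- the slope parameter `λ = min(τ₀, √r/(2 C_g √A₂))`
  obtain ⟨μ₀, hμ₀⟩ : ∃ x : ℝ, x = Real.sqrt r / (2 * B.Cg * Real.sqrt B.A2) := ⟨_, rfl⟩
  have hμ₀0 : 0 < μ₀ := by rw [hμ₀]; positivity
  obtain ⟨lam, hlam⟩ : ∃ x : ℝ, x = min τ₀ μ₀ := ⟨_, rfl⟩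
  have hlam0 : 0 < lam := by rw [hlam]; exact lt_min hτ₀0 hμ₀0
  have hlam1 : lam ≤ τ₀ := by rw [hlam]; exact min_le_left _ _
  have hlam2 : lam ≤ μ₀ := by rw [hlam]; exact min_le_right _ _
  -- slope hypotheses with `η = δ`
  have hloδ : a ≤ μ - δ := by linarith [hδδ₁.trans hδ₁1]
  have hhiδ : μ + δ ≤ b := by linarith [hδδ₁.trans hδ₁1]
  have eκ₂ : B.smax * (B.Cg * (lam + 2 * B.smax * (δ / B.Dtmin))) + δ / B.Dtmin =
      B.smax * B.Cg * lam + κ₂ * δ := by rw [hκ₂]; field_simp; ring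
  have h₀ : B.smax * (B.Cg * (lam + 2 * B.smax * (δ / B.Dtmin))) + δ / B.Dtmin < v := by
    rw [eκ₂]
    have h1 : B.smax * B.Cg * lam ≤ B.smax * B.Cg * τ₀ := mul_le_mul_of_nonneg_left hlam1 (by positivity)
    have h2 : B.smax * B.Cg * τ₀ = v / 4 := by rw [hτ₀]; field_simp
    have h3 : κ₂ * δ ≤ κ₂ * (v / (4 * κ₂)) := mul_le_mul_of_nonneg_left (hδδ₁.trans hδ₁2) hκ₂0.le
    have h4 : κ₂ * (v / (4 * κ₂)) = v / 4 := by field_simp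
    linarith
  have hX1 : B.Cg * lam ≤ Real.sqrt r / (2 * Real.sqrt B.A2) := by
    have h1 : B.Cg * lam ≤ B.Cg * μ₀ := mul_le_mul_of_nonneg_left hlam2 hC.le
    have h2 : B.Cg * μ₀ = Real.sqrt r / (2 * Real.sqrt B.A2) := by rw [hμ₀]; field_simp
    linarith
  have hX2 : B.Cg * (2 * B.smax * (δ / B.Dtmin)) ≤ Real.sqrt r / (2 * Real.sqrt B.A2) := by
    have ha0 : 0 ≤ B.Cg * (2 * B.smax * (δ / B.Dtmin)) := by positivity
    have hb0 : 0 ≤ Real.sqrt r / (2 * Real.sqrt B.A2) := by positivity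
    have hsq : (B.Cg * (2 * B.smax * (δ / B.Dtmin))) ^ 2 ≤ (Real.sqrt r / (2 * Real.sqrt B.A2)) ^ 2 := by
      have e1 : (B.Cg * (2 * B.smax * (δ / B.Dtmin))) ^ 2 = 4 * B.smax ^ 2 * B.Cg ^ 2 / B.Dtmin ^ 2 * δ ^ 2 := by
        ring
      have e2 : (Real.sqrt r / (2 * Real.sqrt B.A2)) ^ 2 = r / (4 * B.A2) := by
        rw [div_pow, mul_pow, Real.sq_sqrt hr0.le, Real.sq_sqrt hA.le]; ring
      rw [e1, e2]
      -- `δ² ≤ δ · Dt² c₀/(16 s² Cg² A₂)` and `c₀ δ ≤ r`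
      have h1 : δ ^ 2 ≤ δ * (B.Dtmin ^ 2 * c₀ / (16 * B.smax ^ 2 * B.Cg ^ 2 * B.A2)) := by
        rw [sq]; exact mul_le_mul_of_nonneg_left (hδδ₁.trans hδ₁3) hδ.le
      have h2 : 4 * B.smax ^ 2 * B.Cg ^ 2 / B.Dtmin ^ 2 *
          (δ * (B.Dtmin ^ 2 * c₀ / (16 * B.smax ^ 2 * B.Cg ^ 2 * B.A2))) = c₀ * δ / (4 * B.A2) := by
        field_simp
        norm_num
      have h3 : 4 * B.smax ^ 2 * B.Cg ^ 2 / B.Dtmin ^ 2 * δ ^ 2 ≤ c₀ * δ / (4 * B.A2) := by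
        rw [← h2]; exact mul_le_mul_of_nonneg_left h1 (by positivity)
      have h4 : c₀ * δ / (4 * B.A2) ≤ r / (4 * B.A2) := div_le_div_of_nonneg_right hr (by positivity)
      linarith
    have := Real.sqrt_le_sqrt hsq
    rwa [Real.sqrt_sq ha0, Real.sqrt_sq hb0] at this
  have h₂ : B.A2 / 4 * (B.Cg * (lam + 2 * B.smax * (δ / B.Dtmin))) ^ 2 + δ / B.Dtmin < r := by
    have hX : B.Cg * (lam + 2 * B.smax * (δ / B.Dtmin)) ≤ Real.sqrt r / Real.sqrt B.A2 := by
      have e : Real.sqrt r / (2 * Real.sqrt B.A2) + Real.sqrt r / (2 * Real.sqrt B.A2) =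
          Real.sqrt r / Real.sqrt B.A2 := by field_simp; ring
      rw [mul_add, ← e]; exact add_le_add hX1 hX2
    have hX0 : 0 ≤ B.Cg * (lam + 2 * B.smax * (δ / B.Dtmin)) := by positivity
    have hsq : (B.Cg * (lam + 2 * B.smax * (δ / B.Dtmin))) ^ 2 ≤ (Real.sqrt r / Real.sqrt B.A2) ^ 2 :=
      pow_le_pow_left₀ hX0 hX 2
    have e2 : (Real.sqrt r / Real.sqrt B.A2) ^ 2 = r / B.A2 := by
      rw [div_pow, Real.sq_sqrt hr0.le, Real.sq_sqrt hA.le]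
    have h1 : B.A2 / 4 * (B.Cg * (lam + 2 * B.smax * (δ / B.Dtmin))) ^ 2 ≤ B.A2 / 4 * (r / B.A2) :=
      mul_le_mul_of_nonneg_left (e2 ▸ hsq) (by positivity)
    have h2 : B.A2 / 4 * (r / B.A2) = r / 4 := by field_simp
    have h3 : δ / B.Dtmin ≤ r / 2 := by
      rw [div_le_iff₀ hD]
      have h3a := hc₀D
      rw [div_le_iff₀ hD] at h3a
      have h3b : 2 * δ ≤ c₀ * B.Dtmin * δ := mul_le_mul_of_nonneg_right h3a hδ.le
      have h3c : B.Dtmin * (c₀ * δ) ≤ B.Dtmin * r := mul_le_mul_of_nonneg_left hr hD.le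
      have h3d : c₀ * B.Dtmin * δ = B.Dtmin * (c₀ * δ) := by ring
      linarith
    linarith
  have hlo₁ : a ≤ μ - η₁ := by linarith
  have hhi₁ : μ + η₁ ≤ b := by linarith
  have hηℓ : 4 * B.smax * ℓ ≤ η₁ := by
    have e : 4 * B.smax * ℓ = η₁ := by rw [hℓ]; field_simp
    exact e.le
  have eκ : B.smax * (B.Cg * (2 * B.smax * (η₁ / B.Dtmin))) + η₁ / B.Dtmin = κ₂ * η₁ := by
    rw [hκ₂]; field_simp
  have hH1c : B.smax * (B.Cg * (2 * B.smax * (η₁ / B.Dtmin))) + η₁ / B.Dtmin < v := by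
    rw [eκ]
    have h1 : κ₂ * η₁ ≤ κ₂ * (v / (2 * κ₂)) := mul_le_mul_of_nonneg_left hη₁4 hκ₂0.le
    have h2 : κ₂ * (v / (2 * κ₂)) = v / 2 := by field_simp
    linarith
  have hρ₂c : B.smax * (B.Cg * (2 * B.smax * (η₁ / B.Dtmin))) +
      B.A2 / 4 * (B.Cg * (2 * B.smax * (η₁ / B.Dtmin))) ^ 2 + η₁ / B.Dtmin + 2 * B.smax * ℓ ≤ ρ₂ := by
    have e : B.smax * (B.Cg * (2 * B.smax * (η₁ / B.Dtmin))) +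
        B.A2 / 4 * (B.Cg * (2 * B.smax * (η₁ / B.Dtmin))) ^ 2 + η₁ / B.Dtmin + 2 * B.smax * ℓ =
        κ₂ * η₁ + B.A2 * B.smax ^ 2 * B.Cg ^ 2 / B.Dtmin ^ 2 * η₁ ^ 2 + η₁ / 2 := by
      rw [hκ₂, hℓ]; field_simp; ring
    rw [e]
    have hη₁sq : η₁ ^ 2 ≤ η₁ := by rw [sq]; exact mul_le_of_le_one_right hη₁0.le hη₁2
    have h1 : B.A2 * B.smax ^ 2 * B.Cg ^ 2 / B.Dtmin ^ 2 * η₁ ^ 2 ≤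
        B.A2 * B.smax ^ 2 * B.Cg ^ 2 / B.Dtmin ^ 2 * η₁ :=
      mul_le_mul_of_nonneg_left hη₁sq (by positivity)
    have h2 : κ₂ * η₁ + B.A2 * B.smax ^ 2 * B.Cg ^ 2 / B.Dtmin ^ 2 * η₁ + η₁ / 2 = κ₄ * η₁ := by
      rw [hκ₄]; ring
    have h3 : κ₄ * η₁ ≤ κ₄ * (ρ₂ / κ₄) := mul_le_mul_of_nonneg_left hη₁3 hκ₄0.le
    have h4 : κ₄ * (ρ₂ / κ₄) = ρ₂ := by field_simp
    linarith
  have hσ : ρ₂ / (Real.sqrt 2 * B.umin) < 2 := by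
    rw [div_lt_iff₀ h2u]; linarith
  have hH4 : 2 * umklappRadius μ + ρ₂ < 2 * π := by
    have : κ₃ ≤ 2 * π - 2 * umklappRadius b := hκ₃ ▸ min_le_right _ _
    linarith
  have hconv : (4 * B.smax ^ 2 + 4 * B.A2) *
      (2 * B.smax * (π * (ρ₂ / (Real.sqrt 2 * B.umin))) + ρ₂) < 4 * B.hmin := by
    have e : (4 * B.smax ^ 2 + 4 * B.A2) * (2 * B.smax * (π * (ρ₂ / (Real.sqrt 2 * B.umin))) + ρ₂) =
        M₃ * ρ₂ := by rw [hM₃]; field_simp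
    rw [e]
    have h1 : M₃ * ρ₂ ≤ M₃ * (2 * B.hmin / M₃) := mul_le_mul_of_nonneg_left hρ₂3 hM₃0.le
    have e2 : M₃ * (2 * B.hmin / M₃) = 2 * B.hmin := by field_simp
    linarith
  have hmain := klsa_volume_sublevel_le_transversal B hμ (θ₀ := θ₀) hloδ hhiδ le_rfl hlam0 hv hr₂ h₀ h₂
    hlo₁ hhi₁ hℓ0 hηℓ hH1c hρ₂c hσ hconv hH4
  refine hmain.trans ?_
  have hx0 : 0 ≤ 2 * π / ℓ + 27 := by positivity
  rw [← ENNReal.ofReal_mul hx0]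
  apply ENNReal.ofReal_le_ofReal
  -- `δ/λ ≤ δ/τ₀ + δ/μ₀` and `δ/μ₀ = 2 C_g √A₂ · δ/√r`
  have hsplit : δ / lam ≤ δ / τ₀ + δ / μ₀ := by
    have hd1 : 0 ≤ δ / τ₀ := by positivity
    have hd2 : 0 ≤ δ / μ₀ := by positivity
    rcases le_total τ₀ μ₀ with h | h
    · rw [hlam, min_eq_left h]; linarith
    · rw [hlam, min_eq_right h]; linarith
  have e1 : (2 * π / ℓ + 27) * (δ / τ₀) = C₁ * δ := by rw [hC₁]; field_simp
  have e2 : (2 * π / ℓ + 27) * (δ / μ₀) = C₃ * δ / Real.sqrt r := by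
    rw [hC₃, hμ₀]; field_simp
  have h1 : (2 * π / ℓ + 27) * (δ / lam) ≤ (2 * π / ℓ + 27) * (δ / τ₀ + δ / μ₀) :=
    mul_le_mul_of_nonneg_left hsplit hx0
  rw [mul_add, e1, e2] at h1
  exact h1

end Main

end Summit.HubbardSuperconductivity.HubbardSuperconductivity.Theorems

end
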